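import Summits.QuantumFields.YangMills.Theorems.BalabanUVNodesN09HeredModFineOfThm1
import Summits.QuantumFields.YangMills.Theorems.BalabanUVNodesN21AveragedDatumRegularity

/-!
# NODE N09 AT THE STAGE-13 v1.7 `SepCoPH` RECORD — THE NESTING BINDER `hnestreg` OF THE ON-DOMAINS DOORS («`Ū^{i+1}(U_k V) ∈ regSet_i(ρ_i) ∩ domAlt_{i+1}`») SUPPLIED:
# its small-field half from [Balaban1985Averaging] Prop. 2 (53) at NODE 00's averaging of record (dag-n21-c's `plaqSmall_iter_Uk_level`, PROVED in the tree) + numerics,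
# its regular-set half from the pointwise (F7a) support clause + hierarchical axiality (FILE 4's HERED) — so the on-domains doors keep ONE (F7a) binder and NO nesting binder

TRACK A (YM-PLAN §2d, node N09 of 28), seat `pub-ymgap-dag-n09-w1` (D-0149 width seat 1∕4, generation 2), FILE 5 (`--supports` K1⁷ stmt-QuantumFields-20542 as a helper) over this seat's
FILE 4 `…N09HeredModFineOfThm1` (⇒ FILES 1–2, n09-w2 g2's `…N09AxialCovariance181`, dag-n09-w3's `…FluctNesting`) and dag-n21-c's `…N21AveragedDatumRegularity` (p469485-lineage:
[B7] Prop. 2 (52)–(54)∕(53) for `Node00.avOfRecord`, kernel theorems).  [I] = [Balaban1987RG1] (CMP 109), [B7] = [Balaban1985Averaging] (CMP 98), [B11] = [Balaban1985Variational] (CMP 102).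
THEOREMS ONLY (0 `def`, 0 `sorry`).

WHY.  The surviving N09 currency (dag-n09-w3 p589797 ∕ n09-w2 g2 p594969: the member ON THE SMALL-FIELD DOMAINS) displays the NESTING binder
`hnestreg : ∀ k ≤ P.K, ∀ V ∈ domAlt_k, ∀ i, i + 1 < k → Ū^{i+1}(U_k V) ∈ regSetOfRecord P.K i ρ_i ∩ domAltOfRecord θ.ν P.K (i+1)` ((F7b) ∧ [I] (1.2)∕(2.1) nesting of the averaged
backgrounds of regular fields).  Its two halves have suppliers the tree now holds:
* §1 THE SMALL-FIELD HALF ★ `iterUk_mem_domAlt_of_ukExists` — «averages of a regular background are small fields»: dag-n21-c's `N21AveragedDatumRegularity.plaqSmall_iter_Uk_level`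
  ([B7] Prop. 2 (53) at `avOfRecord`: `U_k(V) ∈ bgReg(εbg)` ⇒ `|Ū^j(U_k V)(∂p) − 1| < 2εbg(L^jη_k)²`, uniform in `k`) + `(L^jη_k)² ≤ L^{−2}` for `j < k` (`pow_mul_eta_le_inv`) + the numerics
  `0 < εbg`, `C₀(d)εbg ≤ ⅓`, `2εbg ≤ c′₂`, `2εbg ≤ ν.ε₀·L²` ⇒ `Ū^j(U_k V) ∈ domAltOfRecord ν K j` for every `j < k` and every solvable small field `V`.  Corollary ★ `haxcrit_of_haxDom`: n09-w2 g2's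
  ON-DOMAINS axiality `haxDom` gives FILE 4's input `haxcrit` (the averages ARE in the domains).
* §1b ★★ **PROP. 2 [12] SMALLNESS OF THE CRITICAL CONFIGURATION IS A TREE THEOREM ON THE SOLVABLE SET**: `plaqSmall_critCfgOfRecord_of_ukExists` (`|V^{(k)}(W)(∂p) − 1| < 2εreg(L^kη_{k+1})²` for
  solvable `W` — n21-c's (53) at `(K, k+1, εreg)`), `hcrit_of_ukExists` (`PlaqSmall δ (critCfgOfRecord ν K k W)` for `2εreg ≤ δ·L²`), `hcrit_dom_of_hsolv` ∕ `hcrit_dom_of_h11_of_reg8` — node00-def-K0e's displayed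
  `hcrit` of `mem_domAltOfRecord_of_chiFix29_eq_one` and dag-n09-w3 g2's `hcrit` binder of `…N09AtSmallFieldBookkeeping` SUPPLIED on the domains from solvability (FILE 1) + [B7]-numerics on `εreg`.
* §2 THE REGULAR-SET HALF, TOGETHER ★★ `hnestreg_of_suppPt_of_hierAxial_of_reg8` — from the POINTWISE-ON-DOMAINS support clause (F7a)
  `hχregpt : ∀ i, i+1 < K → ∀ U, Ū ∈ domAlt_{i+2} → U ∉ regSet_i ∩ domAlt_{i+1} → χ^{(2.9)}_{i+1}(U) = 0` (the doors' a.e. binder `hχreg` is its `ae_of_all` image, `hχreg_ae_of_suppPt`)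
  and (N29) «`χ^{(2.9)}_{i+1}(Ū^{i+1}(U_k V)) = 1`» (FILE 4 `chiβ13_iterUk_eq_one_of_hierAxial_of_reg8`: [B11] `hres ∕ huniq` at `εbg`, the (8)-membership clause, `0 ≤ εreg ≤ εbg`, the two axialities),
  reading `Ū^{i+2}(U_k V) ∈ domAlt_{i+2}` from §1 (or `= V` at `i + 2 = k`): `1 ≠ 0` forces membership in `regSet_i ∩ domAlt_{i+1}`.
So after FILES 1–5 and n09-w2 g2's doors, N09's member on the small-field domains reads: [B11] Thm 1 ×3 at `εbg` (`h11 ∕ hres ∕ huniq`, N07) + the (8)-membership clause `hreg8` + radii numerics +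
ONE pointwise (F7a) clause (K0e's analytic debt) + (I19)∕(H-U) + the two axiality CONVENTIONS (`haxDom`, `haxbg` — definitional after the re-points on the table) + [B7]-numerics; the junction
itself is n09-w2 g2's ∕ dag-n24-c's to write (their doors), this file supplies binders in their exact shapes.

HONEST FRAMING: count-neutral kernel composition BY NAME; NOTHING of Bałaban's asserted beyond what the tree PROVES ([B7] Prop. 2 at the record IS a tree theorem; [B11] Thm 1's clauses, (F7a),
the axiality conventions stay DISPLAYED); NO carrier re-pointed; N09 NOT discharged; K0⁷ ∕ K1⁷ NOT closed; counts unmoved (typed 28∕28 · discharged 5∕27); one finite four-torus programme at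
fixed ε — R4 closes the conditional rung `BalabanLadder.UV` only; the Yang–Mills mass gap (Clay) is NOT proved by any of this; nothing continuum ∕ ℝ⁴ ∕ OS.  THEOREMS ONLY, standard axioms.
-/

noncomputable section

namespace Summit.QuantumFields.YangMills.BalabanUVNodes.N09NestingOfHierAxial

open MeasureTheory
open Literature.MathematicalPhysics.QuantumFieldTheory.Balaban1983to89
open Literature.MathematicalPhysics.QuantumFieldTheory.Balaban1983to89.T4Continuum (T4Family)
open Literature.MathematicalPhysics.QuantumFieldTheory.Balaban1983to89.Node00
open Literature.MathematicalPhysics.QuantumFieldTheory.Balaban1983to89.ExpMeanLog (deltaSU)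
open Summit.QuantumFields.YangMills.BalabanUVNodes.N09BackgroundRadiiTransfer
open Summit.QuantumFields.YangMills.BalabanUVNodes.N09BackgroundRadiiTransferRestrict (bgReg_anti_level)
open Summit.QuantumFields.YangMills.BalabanUVNodes.N09HeredModFineOfThm1 (chiβ13_iterUk_eq_one_of_hierAxial_of_reg8)
open Summit.QuantumFields.YangMills.Theorems.N21AveragedDatumRegularity (plaqSmall_iter_Uk_level)

variable {F : T4Family} {N : ℕ} [NeZero N]

/-! ## §1. The small-field half: averages of a regular background are small fields ([B7] Prop. 2 (53) at the record + numerics) -/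

/-- `L^j·η_k ≤ L⁻¹` for `j < k` (`η_k = L^{−k}`, `L > 1`): each averaging level below the top gains at least one factor `L⁻¹`. [cite: Balaban1987RG1, (0.1) p.251 (bookkeeping)] -/
theorem pow_mul_eta_le_inv {K j k : ℕ} (hj : j < k) : ((F.P K).L : ℝ) ^ j * (F.P K).eta k ≤ ((F.P K).L : ℝ)⁻¹ := by
  have hL : (1 : ℝ) ≤ (F.P K).L := by exact_mod_cast (F.P K).hL.2.le
  have hL0 : (0 : ℝ) < (F.P K).L := zero_lt_one.trans_le hL
  obtain ⟨m, rfl⟩ : ∃ m, k = j + (m + 1) := ⟨k - j - 1, by omega⟩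
  unfold Params.eta
  rw [pow_add, ← mul_assoc, ← mul_pow, mul_inv_cancel₀ hL0.ne', one_pow, one_mul, pow_succ]
  have h1 : ((F.P K).L : ℝ)⁻¹ ≤ 1 := inv_le_one_of_one_le₀ hL
  have h0 : 0 ≤ ((F.P K).L : ℝ)⁻¹ := inv_nonneg.2 hL0.le
  calc ((F.P K).L : ℝ)⁻¹ ^ m * ((F.P K).L : ℝ)⁻¹ ≤ 1 * ((F.P K).L : ℝ)⁻¹ := by gcongr; exact pow_le_one₀ h0 h1
    _ = ((F.P K).L : ℝ)⁻¹ := one_mul _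

/-- ★ **EVERY PARTIAL AVERAGE OF THE BACKGROUND OF A SOLVABLE FIELD IS A SMALL FIELD** — `Ū^j(U_k V) ∈ domAltOfRecord ν K j` for `j < k`: dag-n21-c's `plaqSmall_iter_Uk_level` ([B7] Prop. 2 (53)
at NODE 00's averaging of record: `|Ū^j(U_k V)(∂p) − 1| < 2εbg(L^jη_k)²` from `U_k V ∈ bgReg(εbg)`, under `0 < εbg`, `C₀(d)εbg ≤ ⅓`, `2εbg ≤ c′₂ = 2δ_N∕((d+4)L)²`) and
`2εbg(L^jη_k)² ≤ 2εbg·L^{−2} ≤ ν.ε₀` (`pow_mul_eta_le_inv`, the numeric `2εbg ≤ ν.ε₀·L²`). [cite: Balaban1985Averaging, Prop. 2 (53) p.26; Balaban1987RG1, (1.2) p.260 and p.259] -/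
theorem iterUk_mem_domAlt_of_ukExists (ν : Stage7Numerics) {εbg : ℝ} {K : ℕ} (hε : 0 < εbg)
    (hε3 : (143 * (((((F.P K).d + 4 : ℕ) : ℝ)) ^ 2 / 4) ^ 2) * εbg ≤ 1 / 3)
    (hε2 : 2 * εbg ≤ 2 * deltaSU (Fin N) / ((((F.P K).d + 4) * (F.P K).L : ℕ) : ℝ) ^ 2) (hε₀ : 2 * εbg ≤ ν.ε₀ * ((F.P K).L : ℝ) ^ 2)
    {k : ℕ} {V : GaugeField (F.P K) k (SU N)} (hex : UkExists F N K k εbg V) {j : ℕ} (hj : j < k) :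
    Averaging.iter (avOfRecord F N K) j (Uk F N K k εbg V) ∈ domAltOfRecord F N ν K j := by
  rw [mem_domAltOfRecord_iff]
  have h := plaqSmall_iter_Uk_level K k hε hε3 hε2 hex hj.le
  have hL0 : (0 : ℝ) < (F.P K).L := by have := (F.P K).L_pos; exact_mod_cast this
  have hη0 : 0 ≤ ((F.P K).L : ℝ) ^ j * (F.P K).eta k := by unfold Params.eta; positivity
  have hsq : (((F.P K).L : ℝ) ^ j * (F.P K).eta k) ^ 2 ≤ (((F.P K).L : ℝ)⁻¹) ^ 2 := pow_le_pow_left₀ hη0 (pow_mul_eta_le_inv hj) 2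
  have hbound : 2 * εbg * (((F.P K).L : ℝ) ^ j * (F.P K).eta k) ^ 2 ≤ ν.ε₀ := by
    calc 2 * εbg * (((F.P K).L : ℝ) ^ j * (F.P K).eta k) ^ 2 ≤ 2 * εbg * (((F.P K).L : ℝ)⁻¹) ^ 2 := by gcongr
      _ = 2 * εbg / ((F.P K).L : ℝ) ^ 2 := by rw [inv_pow, div_eq_mul_inv]
      _ ≤ ν.ε₀ := by rw [div_le_iff₀ (by positivity)]; exact hε₀
  exact fun p => (h p).trans_le hbound

/-- The family form on the small-field domains (solvability from `h11`'s first half). [cite: Balaban1985Averaging, Prop. 2 (53) p.26; Balaban1987RG1, (1.2) p.260] -/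
theorem iterUk_mem_domAlt_of_h11 (ν : Stage7Numerics) {εbg : ℝ} {K : ℕ} (hε : 0 < εbg)
    (hε3 : (143 * (((((F.P K).d + 4 : ℕ) : ℝ)) ^ 2 / 4) ^ 2) * εbg ≤ 1 / 3)
    (hε2 : 2 * εbg ≤ 2 * deltaSU (Fin N) / ((((F.P K).d + 4) * (F.P K).L : ℕ) : ℝ) ^ 2) (hε₀ : 2 * εbg ≤ ν.ε₀ * ((F.P K).L : ℝ) ^ 2)
    (hex : ∀ k, k ≤ K → ∀ V ∈ domAltOfRecord F N ν K k, UkExists F N K k εbg V) :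
    ∀ k, k ≤ K → ∀ V ∈ domAltOfRecord F N ν K k, ∀ j < k, Averaging.iter (avOfRecord F N K) j (Uk F N K k εbg V) ∈ domAltOfRecord F N ν K j :=
  fun k hk V hV _ hj => iterUk_mem_domAlt_of_ukExists ν hε hε3 hε2 hε₀ (hex k hk V hV) hj

/-- ★★ **PROP. 2 [12] SMALLNESS OF THE CRITICAL CONFIGURATION — node00-def-K0e's DISPLAYED `hcrit` IS A TREE THEOREM ON THE SOLVABLE SET**: for every coarse field `W` at which the
level-`(k+1)` problem is solvable at the cut-off's radius `ν.εreg`, the critical configuration of record `V^{(k)}(W) = M^k(U_{k+1}(W))` ([I] (2.3)) has `|V^{(k)}(W)(∂p) − 1| < 2εreg·(L^kη_{k+1})²`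
— dag-n21-c's `plaqSmall_iter_Uk_level` ([B7] Prop. 2 (53) at NODE 00's averaging, PROVED) at `(K, k+1, εreg)`, level `j := k`; numerics `0 < εreg`, `C₀(d)εreg ≤ ⅓`, `2εreg ≤ c′₂`.  K0e's threshold lemma
`mem_domAltOfRecord_of_chiFix29_eq_one` and dag-n09-w3 g2's `…AtSmallFieldBookkeeping` display exactly this as `hcrit` («Prop 2 [12]», [12] = [B7]). [cite: Balaban1985Averaging, Prop. 2 (53) p.26; Balaban1987RG1, (2.3) p.265] -/
theorem plaqSmall_critCfgOfRecord_of_ukExists (ν : Stage7Numerics) {K k : ℕ} (hε : 0 < ν.εreg)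
    (hε3 : (143 * (((((F.P K).d + 4 : ℕ) : ℝ)) ^ 2 / 4) ^ 2) * ν.εreg ≤ 1 / 3)
    (hε2 : 2 * ν.εreg ≤ 2 * deltaSU (Fin N) / ((((F.P K).d + 4) * (F.P K).L : ℕ) : ℝ) ^ 2)
    {W : GaugeField (F.P K) (k + 1) (SU N)} (hW : UkExists F N K (k + 1) ν.εreg W) :
    PlaqSmall (2 * ν.εreg * (((F.P K).L : ℝ) ^ k * (F.P K).eta (k + 1)) ^ 2) (critCfgOfRecord F N ν K k W) := by
  rw [critCfgOfRecord_def]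
  exact plaqSmall_iter_Uk_level K (k + 1) hε hε3 hε2 hW (Nat.le_succ k)

/-- ★★ **`hcrit` IN THE THRESHOLD-LEMMA's SHAPE**: `PlaqSmall δ (critCfgOfRecord ν K k W)` for every solvable `W` and every `δ` with `2εreg ≤ δ·L²` (`(L^kη_{k+1})² ≤ L^{−2}`).
[cite: Balaban1985Averaging, Prop. 2 (53) p.26; Balaban1987RG1, (2.3) p.265 and (2.9) p.266] -/
theorem hcrit_of_ukExists (ν : Stage7Numerics) {K k : ℕ} {δ : ℝ} (hε : 0 < ν.εreg)
    (hε3 : (143 * (((((F.P K).d + 4 : ℕ) : ℝ)) ^ 2 / 4) ^ 2) * ν.εreg ≤ 1 / 3)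
    (hε2 : 2 * ν.εreg ≤ 2 * deltaSU (Fin N) / ((((F.P K).d + 4) * (F.P K).L : ℕ) : ℝ) ^ 2) (hδ : 2 * ν.εreg ≤ δ * ((F.P K).L : ℝ) ^ 2)
    {W : GaugeField (F.P K) (k + 1) (SU N)} (hW : UkExists F N K (k + 1) ν.εreg W) : PlaqSmall δ (critCfgOfRecord F N ν K k W) := by
  have h := plaqSmall_critCfgOfRecord_of_ukExists ν hε hε3 hε2 hW
  have hL0 : (0 : ℝ) < (F.P K).L := by have := (F.P K).L_pos; exact_mod_cast this
  have hη0 : 0 ≤ ((F.P K).L : ℝ) ^ k * (F.P K).eta (k + 1) := by unfold Params.eta; positivity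
  have hsq : (((F.P K).L : ℝ) ^ k * (F.P K).eta (k + 1)) ^ 2 ≤ (((F.P K).L : ℝ)⁻¹) ^ 2 :=
    pow_le_pow_left₀ hη0 (pow_mul_eta_le_inv (Nat.lt_succ_self k)) 2
  have hbound : 2 * ν.εreg * (((F.P K).L : ℝ) ^ k * (F.P K).eta (k + 1)) ^ 2 ≤ δ := by
    calc 2 * ν.εreg * (((F.P K).L : ℝ) ^ k * (F.P K).eta (k + 1)) ^ 2 ≤ 2 * ν.εreg * (((F.P K).L : ℝ)⁻¹) ^ 2 := by gcongr
      _ = 2 * ν.εreg / ((F.P K).L : ℝ) ^ 2 := by rw [inv_pow, div_eq_mul_inv]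
      _ ≤ δ := by rw [div_le_iff₀ (by positivity)]; exact hδ
  exact fun p => (h p).trans_le hbound

/-- ★★ **dag-n09-w3 g2's `hcrit` ON THE SMALL-FIELD DOMAINS** (`…N09AtSmallFieldBookkeeping` binder shape `∀ j < K, ∀ W ∈ domAlt_{j+1}, PlaqSmall δ (critCfgOfRecord ν K j W)`) from solvability of the domains
at the cut-off's radius (`hsolν` — itself from `h11` + `hreg8` + `hle`, FILE 1 `ukExists_εreg_of_h11_of_reg8`) + the [B7]-numerics on `εreg` + `2εreg ≤ δ·L²`. [cite: Balaban1985Averaging, Prop. 2 (53) p.26; Balaban1987RG1, (2.3) p.265] -/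
theorem hcrit_dom_of_hsolv (ν : Stage7Numerics) {K : ℕ} {δ : ℝ} (hε : 0 < ν.εreg)
    (hε3 : (143 * (((((F.P K).d + 4 : ℕ) : ℝ)) ^ 2 / 4) ^ 2) * ν.εreg ≤ 1 / 3)
    (hε2 : 2 * ν.εreg ≤ 2 * deltaSU (Fin N) / ((((F.P K).d + 4) * (F.P K).L : ℕ) : ℝ) ^ 2) (hδ : 2 * ν.εreg ≤ δ * ((F.P K).L : ℝ) ^ 2)
    (hsolv : ∀ j < K, ∀ W ∈ domAltOfRecord F N ν K (j + 1), UkExists F N K (j + 1) ν.εreg W) :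
    ∀ j < K, ∀ W ∈ domAltOfRecord F N ν K (j + 1), PlaqSmall δ (critCfgOfRecord F N ν K j W) :=
  fun j hj W hW => hcrit_of_ukExists ν hε hε3 hε2 hδ (hsolv j hj W hW)

/-- … and from the `εbg`-keyed [B11] slot directly: `h11` + the (8)-membership clause `hreg8` + `εreg ≤ εbg` (FILE 1) + the [B7]-numerics on `εreg`.
[cite: Balaban1985Averaging, Prop. 2 (53) p.26; Balaban1985Variational, Thm 1 (8) p.279; Balaban1987RG1, (2.3) p.265] -/
theorem hcrit_dom_of_h11_of_reg8 (ν : Stage7Numerics) (εbg : ℝ) {K : ℕ} {δ : ℝ} (hε : 0 < ν.εreg)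
    (hε3 : (143 * (((((F.P K).d + 4 : ℕ) : ℝ)) ^ 2 / 4) ^ 2) * ν.εreg ≤ 1 / 3)
    (hε2 : 2 * ν.εreg ≤ 2 * deltaSU (Fin N) / ((((F.P K).d + 4) * (F.P K).L : ℕ) : ℝ) ^ 2) (hδ : 2 * ν.εreg ≤ δ * ((F.P K).L : ℝ) ^ 2)
    (h11 : ∀ k, k ≤ K → ∀ V ∈ domAltOfRecord F N ν K k, UkExists F N K k εbg V ∧ UniqueUkOrbit F N K k εbg V)
    (hreg8 : ∀ k, k ≤ K → ∀ V ∈ domAltOfRecord F N ν K k, Uk F N K k εbg V ∈ bgReg F N K k ν.εreg) (hle : ν.εreg ≤ εbg) :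
    ∀ j < K, ∀ W ∈ domAltOfRecord F N ν K (j + 1), PlaqSmall δ (critCfgOfRecord F N ν K j W) :=
  hcrit_dom_of_hsolv ν hε hε3 hε2 hδ (ukExists_εreg_of_h11_of_reg8 ν εbg K h11 hreg8 hle)

/-- ★ **FILE 4's INPUT `haxcrit` FROM n09-w2 g2's ON-DOMAINS AXIALITY `haxDom`** (`…N09AxialCovariance181OnDomains`: `critCfgOfRecord` axial over every field of `domAlt_{j+1}`): the
averages `Ū^{j+1}(U_k V)` of small fields ARE in `domAlt_{j+1}` (§1 for `j + 1 < k`; `= V` itself for `j + 1 = k`, `iter_Uk`). [cite: Balaban1987RG1, (2.3) p.265 and (1.2) p.260; Balaban1985Averaging, Prop. 2 (53) p.26] -/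
theorem haxcrit_of_haxDom (ν : Stage7Numerics) {εbg : ℝ} {K : ℕ} (cd : (j : ℕ) → ContourData (F.P K) j (SU N)) (hε : 0 < εbg)
    (hε3 : (143 * (((((F.P K).d + 4 : ℕ) : ℝ)) ^ 2 / 4) ^ 2) * εbg ≤ 1 / 3)
    (hε2 : 2 * εbg ≤ 2 * deltaSU (Fin N) / ((((F.P K).d + 4) * (F.P K).L : ℕ) : ℝ) ^ 2) (hε₀ : 2 * εbg ≤ ν.ε₀ * ((F.P K).L : ℝ) ^ 2)
    (hex : ∀ k, k ≤ K → ∀ V ∈ domAltOfRecord F N ν K k, UkExists F N K k εbg V)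
    (haxDom : ∀ j < K, ∀ W ∈ domAltOfRecord F N ν K (j + 1), AxialGauge (cd j) (critCfgOfRecord F N ν K j W)) :
    ∀ k, k ≤ K → ∀ V ∈ domAltOfRecord F N ν K k, ∀ j < k,
      AxialGauge (cd j) (critCfgOfRecord F N ν K j (Averaging.iter (avOfRecord F N K) (j + 1) (Uk F N K k εbg V))) := by
  intro k hk V hV j hj
  refine haxDom j (by omega) _ ?_
  rcases Nat.lt_or_ge (j + 1) k with h | h
  · exact iterUk_mem_domAlt_of_ukExists ν hε hε3 hε2 hε₀ (hex k hk V hV) h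
  · obtain rfl : k = j + 1 := le_antisymm h hj
    rw [iter_Uk (hex (j + 1) hk V hV)]
    exact hV

/-! ## §2. The regular-set half and the whole nesting binder, from the pointwise-on-domains (F7a) + (N29) -/

/-- The doors' a.e. support binder (F7a-dom) is the `ae_of_all` image of the pointwise-on-domains clause `hχregpt` (so a consumer may display `hχregpt` ONCE and feed both).
[cite: Balaban1987RG1, p.256 l.6 and (2.1) p.265 (bookkeeping)] -/
theorem hχreg_ae_of_suppPt (θ₀ : Stage13Params F N) (P : B12.RunParams)
    (hχregpt : ∀ i, i + 1 < P.K → ∀ U : GaugeField (F.P P.K) (i + 1) (SU N),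
      (avOfRecord F N P.K (i + 1)).avg U ∈ domAltOfRecord F N θ₀.ν P.K (i + 2) →
        U ∉ regSetOfRecord F N P.K i (betaInputOfRecord F N (TβOfRecord₁₃ F N) (chiβOfRecord₁₃ F N θ₀) P.K (gOfRecord₁₃ F N θ₀ P) i) ∩
            domAltOfRecord F N θ₀.ν P.K (i + 1) →
          chiβOfRecord₁₃ F N θ₀ P.K (gOfRecord₁₃ F N θ₀ P) (i + 1) U = 0) :
    ∀ i, i + 1 < P.K → ∀ᵐ U ∂(fieldMeasure (F.P P.K) (i + 1) (SU N)),
      (avOfRecord F N P.K (i + 1)).avg U ∈ domAltOfRecord F N θ₀.ν P.K (i + 2) →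
        U ∉ regSetOfRecord F N P.K i (betaInputOfRecord F N (TβOfRecord₁₃ F N) (chiβOfRecord₁₃ F N θ₀) P.K (gOfRecord₁₃ F N θ₀ P) i) ∩
            domAltOfRecord F N θ₀.ν P.K (i + 1) →
          chiβOfRecord₁₃ F N θ₀ P.K (gOfRecord₁₃ F N θ₀ P) (i + 1) U = 0 :=
  fun i hi => Filter.Eventually.of_forall (hχregpt i hi)

/-- ★★ **THE NESTING BINDER `hnestreg` OF THE ON-DOMAINS DOORS, SUPPLIED** (dag-n09-w3 p589797 ∕ n09-w2 g2 p594969, binder shape VERBATIM at `Uk … εbg`, `θ₀.ν`): for every run `P`, level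
`k ≤ P.K`, small field `V ∈ domAlt_k` and `i + 1 < k`, `Ū^{i+1}(U_k V) ∈ regSetOfRecord P.K i ρ_i ∩ domAltOfRecord θ₀.ν P.K (i+1)` — from: the pointwise-on-domains (F7a) clause `hχregpt`;
`0 < θ₀.ε₂₉`; [B11]'s `h11`-existence, `hres`, `huniq` at `εbg`; the (8)-membership clause `hreg8` and `0 ≤ θ₀.ν.εreg ≤ εbg`; the hierarchical axiality `haxbg` and the on-domains axiality
`haxDom` (n09-w2 g2's binder); the [B7]-numerics `0 < εbg`, `C₀(d)εbg ≤ ⅓`, `2εbg ≤ c′₂`, `2εbg ≤ ν.ε₀·L²`.  Mechanism: (N29) `χ^{(2.9)}_{i+1}(Ū^{i+1}(U_k V)) = 1` (FILE 4) at a point whose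
next average `Ū^{i+2}(U_k V)` is a small field (§1, or `V` itself) — so (F7a) at that point cannot fire: the point lies in `regSet_i ∩ domAlt_{i+1}`.
[cite: Balaban1987RG1, (2.1)–(2.3) p.265, (2.9)–(2.10) pp.266–267, (1.2) p.260, p.256 l.6; Balaban1985Averaging, Prop. 2 (53) p.26; Balaban1985Variational, Thm 1 (6) and (8) p.279] -/
theorem hnestreg_of_suppPt_of_hierAxial_of_reg8 (θ₀ : Stage13Params F N) (hεχ : 0 < θ₀.ε₂₉) (P : B12.RunParams) {εbg : ℝ}
    (cd : (j : ℕ) → ContourData (F.P P.K) j (SU N))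
    (hχregpt : ∀ i, i + 1 < P.K → ∀ U : GaugeField (F.P P.K) (i + 1) (SU N),
      (avOfRecord F N P.K (i + 1)).avg U ∈ domAltOfRecord F N θ₀.ν P.K (i + 2) →
        U ∉ regSetOfRecord F N P.K i (betaInputOfRecord F N (TβOfRecord₁₃ F N) (chiβOfRecord₁₃ F N θ₀) P.K (gOfRecord₁₃ F N θ₀ P) i) ∩
            domAltOfRecord F N θ₀.ν P.K (i + 1) →
          chiβOfRecord₁₃ F N θ₀ P.K (gOfRecord₁₃ F N θ₀ P) (i + 1) U = 0)
    (hex : ∀ k, k ≤ P.K → ∀ V ∈ domAltOfRecord F N θ₀.ν P.K k, UkExists F N P.K k εbg V)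
    (hres : ∀ k, k ≤ P.K → HRestrict F N εbg P.K k (domAltOfRecord F N θ₀.ν P.K k))
    (huniq : ∀ k, k ≤ P.K → ∀ V ∈ domAltOfRecord F N θ₀.ν P.K k, ∀ j < k,
      UniqueUkOrbit F N P.K (j + 1) εbg (Averaging.iter (avOfRecord F N P.K) (j + 1) (Uk F N P.K k εbg V)))
    (hreg8 : ∀ k, k ≤ P.K → ∀ V ∈ domAltOfRecord F N θ₀.ν P.K k, Uk F N P.K k εbg V ∈ bgReg F N P.K k θ₀.ν.εreg) (hle : θ₀.ν.εreg ≤ εbg) (hεreg : 0 ≤ θ₀.ν.εreg)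
    (haxbg : ∀ k, k ≤ P.K → ∀ V ∈ domAltOfRecord F N θ₀.ν P.K k, ∀ j < k, AxialGauge (cd j) (Averaging.iter (avOfRecord F N P.K) j (Uk F N P.K k εbg V)))
    (haxDom : ∀ j < P.K, ∀ W ∈ domAltOfRecord F N θ₀.ν P.K (j + 1), AxialGauge (cd j) (critCfgOfRecord F N θ₀.ν P.K j W))
    (hε : 0 < εbg) (hε3 : (143 * (((((F.P P.K).d + 4 : ℕ) : ℝ)) ^ 2 / 4) ^ 2) * εbg ≤ 1 / 3)
    (hε2 : 2 * εbg ≤ 2 * deltaSU (Fin N) / ((((F.P P.K).d + 4) * (F.P P.K).L : ℕ) : ℝ) ^ 2) (hε₀ : 2 * εbg ≤ θ₀.ν.ε₀ * ((F.P P.K).L : ℝ) ^ 2) :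
    ∀ k, k ≤ P.K → ∀ V ∈ domAltOfRecord F N θ₀.ν P.K k, ∀ i, i + 1 < k →
      Averaging.iter (avOfRecord F N P.K) (i + 1) (Uk F N P.K k εbg V) ∈
        regSetOfRecord F N P.K i (betaInputOfRecord F N (TβOfRecord₁₃ F N) (chiβOfRecord₁₃ F N θ₀) P.K (gOfRecord₁₃ F N θ₀ P) i) ∩
          domAltOfRecord F N θ₀.ν P.K (i + 1) := by
  intro k hk V hV i hi
  have haxcrit := haxcrit_of_haxDom θ₀.ν cd hε hε3 hε2 hε₀ hex haxDom
  have hone := chiβ13_iterUk_eq_one_of_hierAxial_of_reg8 θ₀ hεχ P εbg cd hres huniq hreg8 hle hεreg haxbg haxcrit k hk V hV (i + 1) hi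
  -- the next average is a small field
  have hnext : (avOfRecord F N P.K (i + 1)).avg (Averaging.iter (avOfRecord F N P.K) (i + 1) (Uk F N P.K k εbg V)) ∈
      domAltOfRecord F N θ₀.ν P.K (i + 2) := by
    show Averaging.iter (avOfRecord F N P.K) (i + 2) (Uk F N P.K k εbg V) ∈ domAltOfRecord F N θ₀.ν P.K (i + 2)
    rcases Nat.lt_or_ge (i + 2) k with h | h
    · exact iterUk_mem_domAlt_of_ukExists θ₀.ν hε hε3 hε2 hε₀ (hex k hk V hV) h
    · obtain rfl : k = i + 2 := le_antisymm h (by omega)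
      rw [iter_Uk (hex (i + 2) hk V hV)]
      exact hV
  by_contra hn
  exact one_ne_zero (hone ▸ hχregpt i (lt_of_lt_of_le hi hk) _ hnext hn)

end Summit.QuantumFields.YangMills.BalabanUVNodes.N09NestingOfHierAxial

end
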